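import Mathlib
import Summits.Ventures.HodgeRepro.Tier4.Common.LocalCoordinates
import Summits.Ventures.HodgeRepro.Tier4.Common.LocalUnitary
import Summits.Ventures.HodgeRepro.Tier4.Common.TorusInfCompactConj
import Summits.Ventures.HodgeRepro.Tier4.Line4.ProjPlane

/-!
# Tier4/Common/LocalCoordinatesConj — the local coordinates of the SEESAW plane adapted to the TRANSPORTED torus `T′`:
the conjugation `conjTo : G(𝔸)(seesaw) →* G(𝔸)(mixedRow q a₁ a₃)`, `x ↦ g′ x g`, and `locEntry'`, `locMat'` with every
law of LocalCoordinates / LocalUnitary transported by name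

Blind re-derivation cell `pub-hodge-repro`, Tier 4 «prove the step» (README §9–§10), seat t4-typer-2 (gen 4), on
t4-L1-p5 g4's design question S14918 (option (A), claimed S14922).  Target tree path
`lean/Summits/Ventures/HodgeRepro/Tier4/Common/LocalCoordinatesConj.lean`.  Imports: Mathlib + `Common.LocalCoordinates`,
`Common.LocalUnitary` (the laws at the second row plane `W' = ofLinesRow q (a 1) (a 3) (-1)`),
`Common.TorusInfCompactConj` (`torusT'_withTransportedTorus_conj`), `Line4.ProjPlane` (`adMat_mul_adMat_eq_one`,
`adMat_smul`, `adMat_transpose`).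

WHY (L1-p5 S14918): the §15 field `equiv` of `IsArchCoeff` asks the equivariance of the archimedean coefficient under the
SECOND torus `T′ = g T g⁻¹` of the seesaw plane with the transported weights `weightAt' … g g'`, while `D3coeff` (p699431)
is built on `locEntry` — the coordinates in which the FIRST torus is diagonal.  The `T′`-adapted coordinates are the
coordinates of the conjugate: `entryAtConj W w g g' x = entryAt W' w (g′ x g)` (MixedPlaneKType L175), and `g′ x g` lies in
the unitary group of the second row plane `W'` for EVERY `x ∈ G(𝔸)(seesaw)` under the wall's similitude display `hiso`
(ProjPlane's argument, no torus clause).  So: **`conjTo x := g′ x g ∈ GA W'`** (a group homomorphism, continuous),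
**`entryAtConj_eq_entryAt_conjTo`**, **`weightAt'_eq_weightAt_conjTo`**, **`conjTo_mem_torusT_of_mem_torusT'`** (the
transported torus lands in the torus of `W'`), and **`locEntry' x I J := locEntry q (a 1) (a 3) (-1) w (conjTo x) I J`**,
`locMat'` — with `locMat'_mul`, `locMat'_one`, `continuous_locMat'`, `locMat'_mul_J_mul_star` (`J' = diag((a 1)_w, −(a 3)_w)`),
`one_le_norm_locEntry'_zero_zero` / `locEntry'_zero_zero_ne_zero` under the SECOND row's signs, `locEntry'_inv_zero_zero`,
all by name at `conjTo x`.  The `T′`-adapted coefficient `D3coeff' x := (locEntry' x 0 0)⁻¹ ^ 3 = D3coeff q (a 1) (a 3) (-1) w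
(conjTo x)` and its `T′`-laws are then p699431's laws at `conjTo κ` (`conjTo (x κ) = conjTo x · conjTo κ`,
`conjTo κ ∈ torusT W'`) — L1-p5's.

Nothing here says anything about the status of the Hodge conjecture for CM abelian varieties, which is NOT proved
(HC_CM is NOT proved by anyone in this repository).
-/

set_option autoImplicit false

noncomputable section

namespace Summit.Ventures.HodgeRepro.Tier4.Common

open NumberField Matrix Set Topology
open scoped ComplexConjugate

section Conj

variable {k : Type} [Field k] [NumberField k] (q : QuadData k) (a : Fin 4 → k)
  (g g' : Matrix (Fin 4) (Fin 4) k) (hgg' : g * g' = 1) (hg'g : g' * g = 1)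
  (hgΩ : g * (PlaneData.mixedRow q (a 0) (a 2)).Ω = (PlaneData.mixedRow q (a 0) (a 2)).Ω * g)
  (lam : k) (hlam : lam ≠ 0)
  (hiso : g * (PlaneData.mixedRow q (a 1) (a 3)).B * gᵀ = lam • (PlaneData.mixedRow q (a 0) (a 2)).B)

/-- The adelic unit `g′ x g` (`adMat g`, `adMat g′` are mutually inverse units). -/
def conjUnit (x : GA ((PlaneData.mixedRow q (a 0) (a 2)).withTransportedTorus g g' hgg' hg'g hgΩ)) : GL4 k :=
  (⟨adMat k g', adMat k g, Line4.adMat_mul_adMat_eq_one g' g hg'g, Line4.adMat_mul_adMat_eq_one g g' hgg'⟩ : (M4 k)ˣ) *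
    (x : GL4 k) *
    ⟨adMat k g, adMat k g', Line4.adMat_mul_adMat_eq_one g g' hgg', Line4.adMat_mul_adMat_eq_one g' g hg'g⟩

/-- The matrix of `conjUnit x`. -/
theorem coe_conjUnit (x : GA ((PlaneData.mixedRow q (a 0) (a 2)).withTransportedTorus g g' hgg' hg'g hgΩ)) :
    ((conjUnit q a g g' hgg' hg'g hgΩ x : GL4 k) : M4 k) =
      adMat k g' * GA.mat ((PlaneData.mixedRow q (a 0) (a 2)).withTransportedTorus g g' hgg' hg'g hgΩ) x * adMat k g :=
  rfl

include hiso in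
/-- **`g′ x g` lies in the unitary group of the second row plane** (`g′ x g` commutes with `Ω` by `hgΩ`, and preserves
`B₁ = λ g′ B₀ g′ᵀ` by `hiso` — ProjPlane's argument for every `x ∈ G(𝔸)`, no torus clause). -/
theorem conjUnit_mem (x : GA ((PlaneData.mixedRow q (a 0) (a 2)).withTransportedTorus g g' hgg' hg'g hgΩ)) :
    conjUnit q a g g' hgg' hg'g hgΩ x ∈ unitaryGroup (PlaneData.ofLinesRow q (a 1) (a 3) (-1)) := by
  -- the adelic inverse pair
  have hA : adMat k g * adMat k g' = 1 := Line4.adMat_mul_adMat_eq_one g g' hgg'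
  have hA' : adMat k g' * adMat k g = 1 := Line4.adMat_mul_adMat_eq_one g' g hg'g
  -- notation for the matrices of the two planes (the same `Ω` and `P`, the forms `B₀`, `B₁`)
  set M : M4 k := GA.mat ((PlaneData.mixedRow q (a 0) (a 2)).withTransportedTorus g g' hgg' hg'g hgΩ) x with hM
  set Ω : Matrix (Fin 4) (Fin 4) k := (PlaneData.mixedRow q (a 0) (a 2)).Ω with hΩdef
  set B₀ : Matrix (Fin 4) (Fin 4) k := (PlaneData.mixedRow q (a 0) (a 2)).B with hB₀def
  set B₁ : Matrix (Fin 4) (Fin 4) k := (PlaneData.mixedRow q (a 1) (a 3)).B with hB₁def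
  -- the unitary relations of `κ`
  have hΩ : M * adMat k Ω = adMat k Ω * M := x.2.1
  have hB : M * adMat k B₀ * Mᵀ = adMat k B₀ := x.2.2
  -- the conjugate matrix
  set M' : M4 k := adMat k g' * M * adMat k g with hM'
  -- (b) `M'` commutes with `Ω`
  have h1 : adMat k g * adMat k Ω = adMat k Ω * adMat k g := by
    rw [← adMat_mul, ← adMat_mul]
    exact congrArg (adMat k) hgΩ
  have hgΩ' : adMat k g' * adMat k Ω = adMat k Ω * adMat k g' := by
    have e : adMat k g' * adMat k Ω = adMat k g' * (adMat k Ω * adMat k g) * adMat k g' := by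
      rw [Matrix.mul_assoc, Matrix.mul_assoc, hA, Matrix.mul_one]
    rw [e, ← h1, ← Matrix.mul_assoc, hA', Matrix.one_mul]
  have hΩ' : M' * adMat k Ω = adMat k Ω * M' := by
    rw [hM']
    calc adMat k g' * M * adMat k g * adMat k Ω = adMat k g' * M * (adMat k g * adMat k Ω) := by
          rw [Matrix.mul_assoc]
      _ = adMat k g' * M * (adMat k Ω * adMat k g) := by rw [h1]
      _ = adMat k g' * (M * adMat k Ω) * adMat k g := by simp only [Matrix.mul_assoc]
      _ = adMat k g' * (adMat k Ω * M) * adMat k g := by rw [hΩ]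
      _ = (adMat k g' * adMat k Ω) * M * adMat k g := by simp only [Matrix.mul_assoc]
      _ = (adMat k Ω * adMat k g') * M * adMat k g := by rw [hgΩ']
      _ = adMat k Ω * (adMat k g' * M * adMat k g) := by simp only [Matrix.mul_assoc]
  -- (c) `B₁ = λ · g' B₀ g'ᵀ` and `M'` preserves `B₁`
  have hB₁ : B₁ = lam • (g' * B₀ * g'ᵀ) := by
    have e : B₁ = g' * (g * B₁ * gᵀ) * g'ᵀ := by
      calc B₁ = (g' * g) * B₁ * (g' * g)ᵀ := by
            rw [hg'g, Matrix.transpose_one, Matrix.one_mul, Matrix.mul_one]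
        _ = g' * (g * B₁ * gᵀ) * g'ᵀ := by
            rw [Matrix.transpose_mul]
            simp only [Matrix.mul_assoc]
    rw [e, hiso, Matrix.mul_smul, Matrix.smul_mul]
  have hB₁A : adMat k B₁ = algebraMap k (Ad k) lam • (adMat k g' * adMat k B₀ * (adMat k g')ᵀ) := by
    rw [hB₁, Line4.adMat_smul, adMat_mul, adMat_mul, Line4.adMat_transpose]
  have hB' : M' * adMat k B₁ * M'ᵀ = adMat k B₁ := by
    have hT : (adMat k g')ᵀ * (adMat k g)ᵀ = 1 := by
      rw [← Matrix.transpose_mul, hA, Matrix.transpose_one]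
    have key : M' * (adMat k g' * adMat k B₀ * (adMat k g')ᵀ) * M'ᵀ = adMat k g' * adMat k B₀ * (adMat k g')ᵀ := by
      rw [hM']
      calc adMat k g' * M * adMat k g * (adMat k g' * adMat k B₀ * (adMat k g')ᵀ) * (adMat k g' * M * adMat k g)ᵀ
          = adMat k g' * (M * ((adMat k g * adMat k g') *
              (adMat k B₀ * (((adMat k g')ᵀ * (adMat k g)ᵀ) * (Mᵀ * (adMat k g')ᵀ))))) := by
            rw [Matrix.transpose_mul, Matrix.transpose_mul]
            simp only [Matrix.mul_assoc]
        _ = adMat k g' * (M * (adMat k B₀ * (Mᵀ * (adMat k g')ᵀ))) := by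
            rw [hA, Matrix.one_mul, hT, Matrix.one_mul]
        _ = adMat k g' * ((M * adMat k B₀ * Mᵀ) * (adMat k g')ᵀ) := by simp only [Matrix.mul_assoc]
        _ = adMat k g' * adMat k B₀ * (adMat k g')ᵀ := by rw [hB]; simp only [Matrix.mul_assoc]
    rw [hB₁A, Matrix.mul_smul, Matrix.smul_mul, key]
  -- `M'` is a unit: `adMat g'`, `M`, `adMat g` are
  let ug : (M4 k)ˣ := ⟨adMat k g, adMat k g', hA, hA'⟩
  let ug' : (M4 k)ˣ := ⟨adMat k g', adMat k g, hA', hA⟩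
  let u : (M4 k)ˣ := ug' * (x : GL4 k) * ug
  have hu : (u : M4 k) = M' := by
    rw [hM']
    show ((ug' * (x : GL4 k) * ug : (M4 k)ˣ) : M4 k) = _
    rw [Units.val_mul, Units.val_mul]
  have humem : u ∈ unitaryGroup (PlaneData.ofLinesRow q (a 1) (a 3) (-1)) := by
    rw [mem_unitaryGroup, hu]
    exact ⟨hΩ', hB'⟩
  exact humem


/-- **The conjugation `x ↦ g′ x g`** as an element of `G(𝔸)(mixedRow q a₁ a₃)`. -/
def conjTo (x : GA ((PlaneData.mixedRow q (a 0) (a 2)).withTransportedTorus g g' hgg' hg'g hgΩ)) :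
    GA (PlaneData.ofLinesRow q (a 1) (a 3) (-1)) :=
  ⟨conjUnit q a g g' hgg' hg'g hgΩ x, conjUnit_mem q a g g' hgg' hg'g hgΩ lam hiso x⟩

/-- The matrix of the conjugate. -/
theorem mat_conjTo (x : GA ((PlaneData.mixedRow q (a 0) (a 2)).withTransportedTorus g g' hgg' hg'g hgΩ)) :
    GA.mat (PlaneData.ofLinesRow q (a 1) (a 3) (-1)) (conjTo q a g g' hgg' hg'g hgΩ lam hiso x) =
      adMat k g' * GA.mat ((PlaneData.mixedRow q (a 0) (a 2)).withTransportedTorus g g' hgg' hg'g hgΩ) x * adMat k g :=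
  rfl

/-- The conjugation is multiplicative (`g g′ = 1`). -/
theorem conjTo_mul (x y : GA ((PlaneData.mixedRow q (a 0) (a 2)).withTransportedTorus g g' hgg' hg'g hgΩ)) :
    conjTo q a g g' hgg' hg'g hgΩ lam hiso (x * y) =
      conjTo q a g g' hgg' hg'g hgΩ lam hiso x * conjTo q a g g' hgg' hg'g hgΩ lam hiso y := by
  apply Subtype.ext
  apply Units.ext
  change GA.mat _ (conjTo q a g g' hgg' hg'g hgΩ lam hiso (x * y)) =
    GA.mat _ (conjTo q a g g' hgg' hg'g hgΩ lam hiso x) * GA.mat _ (conjTo q a g g' hgg' hg'g hgΩ lam hiso y)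
  rw [mat_conjTo, mat_conjTo, mat_conjTo, GA.mat_mul]
  have hA : adMat k g * adMat k g' = 1 := Line4.adMat_mul_adMat_eq_one g g' hgg'
  calc adMat k g' * (GA.mat _ x * GA.mat _ y) * adMat k g
      = adMat k g' * GA.mat _ x * (adMat k g * adMat k g') * GA.mat _ y * adMat k g := by
        rw [hA, Matrix.mul_one]; simp only [Matrix.mul_assoc]
    _ = adMat k g' * GA.mat _ x * adMat k g * (adMat k g' * GA.mat _ y * adMat k g) := by
        simp only [Matrix.mul_assoc]

/-- The conjugation of `1`. -/
theorem conjTo_one :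
    conjTo q a g g' hgg' hg'g hgΩ lam hiso (1 : GA ((PlaneData.mixedRow q (a 0) (a 2)).withTransportedTorus g g' hgg' hg'g hgΩ)) = 1 := by
  apply Subtype.ext
  apply Units.ext
  change GA.mat _ (conjTo q a g g' hgg' hg'g hgΩ lam hiso 1) = 1
  rw [mat_conjTo]
  have h1 : GA.mat ((PlaneData.mixedRow q (a 0) (a 2)).withTransportedTorus g g' hgg' hg'g hgΩ) 1 = 1 := rfl
  rw [h1, Matrix.mul_one]
  exact Line4.adMat_mul_adMat_eq_one g' g hg'g

/-- **The conjugation as a group homomorphism** `G(𝔸)(seesaw) →* G(𝔸)(mixedRow q a₁ a₃)`. -/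
def conjToHom : GA ((PlaneData.mixedRow q (a 0) (a 2)).withTransportedTorus g g' hgg' hg'g hgΩ) →*
    GA (PlaneData.ofLinesRow q (a 1) (a 3) (-1)) where
  toFun := conjTo q a g g' hgg' hg'g hgΩ lam hiso
  map_one' := conjTo_one q a g g' hgg' hg'g hgΩ lam hiso
  map_mul' := conjTo_mul q a g g' hgg' hg'g hgΩ lam hiso

/-- The conjugation is continuous (a product of units, the middle factor the inclusion). -/
theorem continuous_conjTo : Continuous (conjTo q a g g' hgg' hg'g hgΩ lam hiso) :=
  Continuous.subtype_mk ((continuous_const.mul continuous_subtype_val).mul continuous_const) _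

/-- **The transported entries are the entries of the conjugate**: `entryAtConj W w g g' x i j = entryAt W' w (conjTo x) i j`. -/
theorem entryAtConj_eq_entryAt_conjTo (w : InfinitePlace k)
    (x : GA ((PlaneData.mixedRow q (a 0) (a 2)).withTransportedTorus g g' hgg' hg'g hgΩ)) (i j : Fin 4) :
    entryAtConj ((PlaneData.mixedRow q (a 0) (a 2)).withTransportedTorus g g' hgg' hg'g hgΩ) w g g' x i j =
      entryAt (PlaneData.ofLinesRow q (a 1) (a 3) (-1)) w (conjTo q a g g' hgg' hg'g hgΩ lam hiso x) i j := by
  simp only [entryAtConj, entryAt_eq_adToC, adToC, RingHom.comp_apply, mat_conjTo]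
  congr 1

/-- **The transported weight is the weight of the conjugate.** -/
theorem weightAt'_eq_weightAt_conjTo (w : InfinitePlace k)
    (x : GA ((PlaneData.mixedRow q (a 0) (a 2)).withTransportedTorus g g' hgg' hg'g hgΩ)) (j : Fin 2) :
    weightAt' ((PlaneData.mixedRow q (a 0) (a 2)).withTransportedTorus g g' hgg' hg'g hgΩ) q w g g' j x =
      weightAt (PlaneData.ofLinesRow q (a 1) (a 3) (-1)) q w j (conjTo q a g g' hgg' hg'g hgΩ lam hiso x) :=
  weightAt'_eq_weightAt_of_mat q w _ _ g g' x _ (mat_conjTo q a g g' hgg' hg'g hgΩ lam hiso x) j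

include hlam in
/-- **The transported torus lands in the torus of the second row plane.** -/
theorem conjTo_mem_torusT_of_mem_torusT'
    {κ : GA ((PlaneData.mixedRow q (a 0) (a 2)).withTransportedTorus g g' hgg' hg'g hgΩ)}
    (hκ : κ ∈ torusT' ((PlaneData.mixedRow q (a 0) (a 2)).withTransportedTorus g g' hgg' hg'g hgΩ)) :
    conjTo q a g g' hgg' hg'g hgΩ lam hiso κ ∈ torusT (PlaneData.ofLinesRow q (a 1) (a 3) (-1)) := by
  obtain ⟨κ', hκ'T, hκ'mat⟩ := torusT'_withTransportedTorus_conj q a g g' hgg' hg'g hgΩ lam hlam hiso κ hκ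
  have h : κ' = conjTo q a g g' hgg' hg'g hgΩ lam hiso κ := by
    apply Subtype.ext
    apply Units.ext
    exact hκ'mat
  rw [← h]
  exact hκ'T

include hlam in
/-- The conjugate of an element of `T′_w` lies in `T_w` of the second row plane. -/
theorem conjTo_mem_localTorusAt_of_mem_localTorusAt' (w : InfinitePlace k)
    {κ : GA ((PlaneData.mixedRow q (a 0) (a 2)).withTransportedTorus g g' hgg' hg'g hgΩ)}
    (hκ : κ ∈ localTorusAt' ((PlaneData.mixedRow q (a 0) (a 2)).withTransportedTorus g g' hgg' hg'g hgΩ) w) :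
    conjTo q a g g' hgg' hg'g hgΩ lam hiso κ ∈ localTorusAt (PlaneData.ofLinesRow q (a 1) (a 3) (-1)) w :=
  ⟨conjTo_mem_torusT_of_mem_torusT' q a g g' hgg' hg'g hgΩ lam hlam hiso hκ.1,
    isAtPlace_conj g g' (Line4.adMat_mul_adMat_eq_one g' g hg'g) hκ.2
      (mat_conjTo q a g g' hgg' hg'g hgΩ lam hiso κ)⟩

end Conj

section Coordinates'

variable {k : Type} [Field k] [NumberField k] (q : QuadData k) (a : Fin 4 → k)
  (g g' : Matrix (Fin 4) (Fin 4) k) (hgg' : g * g' = 1) (hg'g : g' * g = 1)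
  (hgΩ : g * (PlaneData.mixedRow q (a 0) (a 2)).Ω = (PlaneData.mixedRow q (a 0) (a 2)).Ω * g)
  (lam : k) (hlam : lam ≠ 0)
  (hiso : g * (PlaneData.mixedRow q (a 1) (a 3)).B * gᵀ = lam • (PlaneData.mixedRow q (a 0) (a 2)).B)
  (w : InfinitePlace k)

/-- **The `T′`-adapted complex coordinates of the seesaw plane at `w`**: the coordinates of `g′ x g` in the second row
plane (`entryAtConj`-based: `locEntry' x j j = weightAt' … j x`). -/
def locEntry' (x : GA ((PlaneData.mixedRow q (a 0) (a 2)).withTransportedTorus g g' hgg' hg'g hgΩ)) (I J : Fin 2) : ℂ :=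
  locEntry q (a 1) (a 3) (-1) w (conjTo q a g g' hgg' hg'g hgΩ lam hiso x) I J

/-- The `T′`-adapted local matrix. -/
def locMat' (x : GA ((PlaneData.mixedRow q (a 0) (a 2)).withTransportedTorus g g' hgg' hg'g hgΩ)) :
    Matrix (Fin 2) (Fin 2) ℂ :=
  locMat q (a 1) (a 3) (-1) w (conjTo q a g g' hgg' hg'g hgΩ lam hiso x)

/-- `locMat'` is `locMat` of the conjugate. -/
theorem locMat'_eq (x : GA ((PlaneData.mixedRow q (a 0) (a 2)).withTransportedTorus g g' hgg' hg'g hgΩ)) :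
    locMat' q a g g' hgg' hg'g hgΩ lam hiso w x =
      locMat q (a 1) (a 3) (-1) w (conjTo q a g g' hgg' hg'g hgΩ lam hiso x) := rfl

/-- `locMat'` entrywise. -/
theorem locMat'_apply (x : GA ((PlaneData.mixedRow q (a 0) (a 2)).withTransportedTorus g g' hgg' hg'g hgΩ)) (I J : Fin 2) :
    locMat' q a g g' hgg' hg'g hgΩ lam hiso w x I J = locEntry' q a g g' hgg' hg'g hgΩ lam hiso w x I J := rfl

/-- **The diagonal of `locMat'` is the transported weight** `weightAt' … j x`. -/
theorem locEntry'_diag_eq_weightAt' (x : GA ((PlaneData.mixedRow q (a 0) (a 2)).withTransportedTorus g g' hgg' hg'g hgΩ))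
    (j : Fin 2) :
    locEntry' q a g g' hgg' hg'g hgΩ lam hiso w x j j =
      weightAt' ((PlaneData.mixedRow q (a 0) (a 2)).withTransportedTorus g g' hgg' hg'g hgΩ) q w g g' j x := by
  rw [locEntry', locEntry_diag_eq_weightAt, weightAt'_eq_weightAt_conjTo]

/-- `locEntry'` through `entryAtConj` (the shape L1-p5 named). -/
theorem locEntry'_eq_entryAtConj (x : GA ((PlaneData.mixedRow q (a 0) (a 2)).withTransportedTorus g g' hgg' hg'g hgΩ))
    (I J : Fin 2) :
    locEntry' q a g g' hgg' hg'g hgΩ lam hiso w x I J =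
      entryAtConj ((PlaneData.mixedRow q (a 0) (a 2)).withTransportedTorus g g' hgg' hg'g hgΩ) w g g' x (lineBase I) (lineBase J) +
        entryAtConj ((PlaneData.mixedRow q (a 0) (a 2)).withTransportedTorus g g' hgg' hg'g hgΩ) w g g' x (lineOmega I) (lineBase J) *
          wroot q w := by
  rw [locEntry', locEntry, entryAtConj_eq_entryAt_conjTo, entryAtConj_eq_entryAt_conjTo]

/-- **`locMat'` is multiplicative** at a real CM place. -/
theorem locMat'_mul (hw : w.IsReal) (hcm : IsCMAt q w)
    (x y : GA ((PlaneData.mixedRow q (a 0) (a 2)).withTransportedTorus g g' hgg' hg'g hgΩ)) :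
    locMat' q a g g' hgg' hg'g hgΩ lam hiso w (x * y) =
      locMat' q a g g' hgg' hg'g hgΩ lam hiso w x * locMat' q a g g' hgg' hg'g hgΩ lam hiso w y := by
  rw [locMat'_eq, locMat'_eq, locMat'_eq, conjTo_mul, locMat_mul q (a 1) (a 3) (-1) w hw hcm]

/-- **`locMat' 1 = 1`.** -/
theorem locMat'_one : locMat' q a g g' hgg' hg'g hgΩ lam hiso w 1 = 1 := by
  rw [locMat'_eq, conjTo_one, locMat_one]

/-- `locMat'` is continuous. -/
theorem continuous_locMat' : Continuous (locMat' q a g g' hgg' hg'g hgΩ lam hiso w) :=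
  (continuous_locMat q (a 1) (a 3) (-1) w).comp (continuous_conjTo q a g g' hgg' hg'g hgΩ lam hiso)

/-- `locEntry'` is continuous. -/
theorem continuous_locEntry' (I J : Fin 2) :
    Continuous fun x => locEntry' q a g g' hgg' hg'g hgΩ lam hiso w x I J :=
  (continuous_locEntry q (a 1) (a 3) (-1) w I J).comp (continuous_conjTo q a g g' hgg' hg'g hgΩ lam hiso)

/-- **The unitary relation in the `T′`-adapted coordinates**: `locMat' x * J′ * (locMat' x)ᴴ = J′` with
`J′ = diag((a 1)_w, (−a 3)_w)` — the Hermitian form of the SECOND row plane. -/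
theorem locMat'_mul_J_mul_star (hw : w.IsReal) (hcm : IsCMAt q w)
    (x : GA ((PlaneData.mixedRow q (a 0) (a 2)).withTransportedTorus g g' hgg' hg'g hgΩ)) :
    locMat' q a g g' hgg' hg'g hgΩ lam hiso w x * Jdiag (a 1) (a 3) (-1) w *
        (locMat' q a g g' hgg' hg'g hgΩ lam hiso w x)ᴴ = Jdiag (a 1) (a 3) (-1) w :=
  locMat_mul_J_mul_star q (a 1) (a 3) (-1) w hw hcm (disc_ne_zero_of_isCMAt q w hw hcm) _

/-- **`‖α′‖ ≥ 1`** under the second row's signs: `0 < (a 1)_w`, `(−a 3)_w < 0`. -/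
theorem one_le_norm_locEntry'_zero_zero (hw : w.IsReal) (hcm : IsCMAt q w)
    (ha1 : 0 < (adToC w (algebraMap k (Ad k) (a 1))).re) (ha3 : (adToC w (algebraMap k (Ad k) (-1 * a 3))).re < 0)
    (x : GA ((PlaneData.mixedRow q (a 0) (a 2)).withTransportedTorus g g' hgg' hg'g hgΩ)) :
    1 ≤ ‖locEntry' q a g g' hgg' hg'g hgΩ lam hiso w x 0 0‖ :=
  one_le_norm_locEntry_zero_zero q (a 1) (a 3) (-1) w hw hcm (disc_ne_zero_of_isCMAt q w hw hcm) ha1 ha3 _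

/-- **`α′ ≠ 0`** under the second row's signs. -/
theorem locEntry'_zero_zero_ne_zero (hw : w.IsReal) (hcm : IsCMAt q w)
    (ha1 : 0 < (adToC w (algebraMap k (Ad k) (a 1))).re) (ha3 : (adToC w (algebraMap k (Ad k) (-1 * a 3))).re < 0)
    (x : GA ((PlaneData.mixedRow q (a 0) (a 2)).withTransportedTorus g g' hgg' hg'g hgΩ)) :
    locEntry' q a g g' hgg' hg'g hgΩ lam hiso w x 0 0 ≠ 0 :=
  locEntry_zero_zero_ne_zero q (a 1) (a 3) (-1) w hw hcm (disc_ne_zero_of_isCMAt q w hw hcm) ha1 ha3 _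

/-- **`α′(x⁻¹) = conj α′(x)`** when `(a 1)_w ≠ 0`. -/
theorem locEntry'_inv_zero_zero (hw : w.IsReal) (hcm : IsCMAt q w) (ha1 : adToC w (algebraMap k (Ad k) (a 1)) ≠ 0)
    (x : GA ((PlaneData.mixedRow q (a 0) (a 2)).withTransportedTorus g g' hgg' hg'g hgΩ)) :
    locEntry' q a g g' hgg' hg'g hgΩ lam hiso w x⁻¹ 0 0 =
      conj (locEntry' q a g g' hgg' hg'g hgΩ lam hiso w x 0 0) := by
  have hinv : conjTo q a g g' hgg' hg'g hgΩ lam hiso x⁻¹ = (conjTo q a g g' hgg' hg'g hgΩ lam hiso x)⁻¹ :=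
    map_inv (conjToHom q a g g' hgg' hg'g hgΩ lam hiso) x
  rw [locEntry', locEntry', hinv]
  exact locEntry_inv_zero_zero q (a 1) (a 3) (-1) w hw hcm (disc_ne_zero_of_isCMAt q w hw hcm) ha1 _

end Coordinates'

end Summit.Ventures.HodgeRepro.Tier4.Common

end
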